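import Mathlib
import Literature.Computability.AlgebraicComplexity.NewtonPolygonTauProofs
import Literature.Combinatorics.Extremal.MonotoneArcCrossing
import HarnessLib

/-!
# KPTT 2015, Theorems 4, 5 and 6 — discharged

Discharge (D-0014) of the named facts `KPTT.theorem5` and `KPTT.theorem6` of
`Literature/Computability/AlgebraicComplexity/NewtonPolygonTau.lean` (P. Koiran, N. Portier,
S. Tavenas, S. Thomassé, *A τ-conjecture for Newton polygons*, Found. Comput. Math. 15 (2015)
185–197, §4): the Newton polygon of `Σ_{i<k} f_i g_i` (`f_i` `r`-sparse, `g_i` `s`-sparse) has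
`O(k (r^{2/3} s^{2/3} + r + s))` vertices, and that of `Σ_{i<k} Π_{j<m} f_ij` (`m ≥ 2`, `t`-sparse
factors) has `O(k t^{2m/3})` vertices, over any field: `KPTT.theorem5_holds`, `KPTT.theorem6_holds`.

The printed proofs were already in the tree as reductions:
`KPTT.theorem5_of_minkowski_convexIndependent_bound` (Theorem 5 from KPTT's Theorem 4, the
Eisenbrand–Pach–Rothvoß–Sopher bound) and `KPTT.theorem6_of_theorem5`. This file proves the
missing ingredient, **KPTT Theorem 4 = [EisenbrandEtAl2008, Thm 1]**, in the effective form

  `KPTT.EPRS.card_le_of_convexIndependent_subset_add :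
      S ⊆ P + Q convexly independent ⇒ #S ≤ 16 · (#P^{2/3} #Q^{2/3} + #P + #Q)`,

following EPRS's proof (their Thm 2 + the Pach–Sharir incidence bound, display (1)), made
self-contained by Székely's crossing-number method on the crossing lemma for `x`-monotone arc
systems (`Literature.Combinatorics.Extremal.ArcSystem.crossing_inequality`):

1. *Translates of a strictly convex graph* (`KPTT.Szekely.*`). For `φ` strictly convex, the
   translates `x ↦ φ (x + q₁) - q₂` have pairwise strictly monotone (or nonzero constant)
   differences: two of them meet at most once, two points lie on at most one of them. Joining
   consecutive points of `P` along each translate gives a simple `x`-monotone arc system with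
   `e ≥ I - #Q` arcs and `≤ #Q²` ordered crossing pairs, whence the incidence bound
   `I ≤ 4 #P^{2/3} #Q^{2/3} + 8 #P + #Q` (`KPTT.Szekely.card_incidences_le`).
2. *EPRS Theorem 2, effective* (`KPTT.EPRS.*`). Every point of a convexly independent finite
   `S ⊆ ℝ²` has a strict lower or a strict upper supporting line against the other points
   (Hahn–Banach); through the "lower" points passes the graph of an explicit strictly convex
   continuous function (a maximum of thin parabolas); a lower point `s = p + q ∈ P + Q` is then an
   incidence of `p` with the translate by `-q`; upper points are lower points of `-S ⊆ -P + -Q`.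

The file is theorem-only (the auxiliary finite sets are explicit `Finset.filter` expressions).

## References

* P. Koiran, N. Portier, S. Tavenas, S. Thomassé, Found. Comput. Math. 15 (2015) 185–197,
  arXiv:1308.2286: Theorems 4, 5, 6 (§4) [KoiranPortierTavenasThomasse2015].
* F. Eisenbrand, J. Pach, T. Rothvoß, N. B. Sopher, *Convexly independent subsets of the
  Minkowski sum of planar point sets*, Electron. J. Combin. 15 (2008) #N8, Theorems 1–2 and
  display (1) [EisenbrandEtAl2008].
* J. Pach, M. Sharir, Combin. Probab. Comput. 7 (1998) 121–127 [PachSharir1998]; L. A. Székely,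
  Combin. Probab. Comput. 6 (1997) 353–358 [Szekely1997].
-/

noncomputable section

open Set Filter Topology

namespace Literature.Computability.AlgebraicComplexity

namespace KPTT

open Literature.Combinatorics.Extremal

/-! ## 1. Incidences between points and translates of a strictly convex graph -/

namespace Szekely

variable {φ : ℝ → ℝ}

/-- Four-point form of strict convexity: if `u < v < v'` and `v + u' = u + v'`, then
`φ v + φ u' < φ u + φ v'`. [folklore] -/
theorem add_lt_add_of_strictConvexOn (hφ : StrictConvexOn ℝ univ φ) {u v u' v' : ℝ}
    (huv : u < v) (hvv' : v < v') (hsum : v + u' = u + v') :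
    φ v + φ u' < φ u + φ v' := by
  have hd : 0 < v' - u := by linarith
  set a := (v' - v) / (v' - u) with ha
  set b := (v - u) / (v' - u) with hb
  have ha0 : 0 < a := div_pos (by linarith) hd
  have hb0 : 0 < b := div_pos (by linarith) hd
  have hab : a + b = 1 := by
    rw [ha, hb, ← add_div, div_eq_one_iff_eq hd.ne']
    ring
  have hne : u ≠ v' := by linarith
  have h1 := hφ.2 (mem_univ u) (mem_univ v') hne ha0 hb0 hab
  have h2 := hφ.2 (mem_univ u) (mem_univ v') hne hb0 ha0 (by linarith)
  have hv : a • u + b • v' = v := by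
    simp only [smul_eq_mul, ha, hb]
    field_simp
    ring
  have hu'eq : u' = u + v' - v := by linarith
  have hu' : b • u + a • v' = u' := by
    rw [hu'eq]
    simp only [smul_eq_mul, ha, hb]
    field_simp
    ring
  rw [hv] at h1
  rw [hu'] at h2
  simp only [smul_eq_mul] at h1 h2
  have hs : a * φ u + b * φ v' + (b * φ u + a * φ v') = φ u + φ v' := by
    calc a * φ u + b * φ v' + (b * φ u + a * φ v') = (a + b) * (φ u + φ v') := by ring
      _ = φ u + φ v' := by rw [hab, one_mul]
  linarith

/-- For `a < a'`, `x ↦ φ (x + a') - φ (x + a)` is strictly increasing. [folklore] -/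
theorem strictMono_sub (hφ : StrictConvexOn ℝ univ φ) {a a' : ℝ} (h : a < a') :
    StrictMono fun x => φ (x + a') - φ (x + a) := by
  intro x y hxy
  have := add_lt_add_of_strictConvexOn hφ (u := x + a) (v := x + a') (u' := y + a) (v' := y + a')
    (by linarith) (by linarith) (by ring)
  dsimp only
  linarith

/-- Two distinct translates of the graph of `φ` meet above at most one abscissa. [folklore] -/
theorem eq_of_translate_eq (hφ : StrictConvexOn ℝ univ φ) {q q' : ℝ × ℝ} (hq : q ≠ q') {x y : ℝ}
    (hx : φ (x + q.1) - q.2 = φ (x + q'.1) - q'.2) (hy : φ (y + q.1) - q.2 = φ (y + q'.1) - q'.2) :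
    x = y := by
  rcases lt_trichotomy q.1 q'.1 with hlt | heq | hgt
  · have hm := strictMono_sub hφ hlt
    exact hm.injective (show φ (x + q'.1) - φ (x + q.1) = φ (y + q'.1) - φ (y + q.1) by linarith)
  · exfalso
    apply hq
    refine Prod.ext heq ?_
    rw [heq] at hx
    linarith
  · have hm := strictMono_sub hφ hgt
    exact hm.injective (show φ (x + q.1) - φ (x + q'.1) = φ (y + q.1) - φ (y + q'.1) by linarith)

/-- Two distinct points lie on at most one common translate. [folklore] -/
theorem eq_of_inc_inc (hφ : StrictConvexOn ℝ univ φ) {p p' q q' : ℝ × ℝ} (hp : p ≠ p')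
    (h1 : p.2 = φ (p.1 + q.1) - q.2) (h2 : p.2 = φ (p.1 + q'.1) - q'.2)
    (h3 : p'.2 = φ (p'.1 + q.1) - q.2) (h4 : p'.2 = φ (p'.1 + q'.1) - q'.2) : q = q' := by
  by_contra hq
  have h := eq_of_translate_eq hφ hq (by rw [← h1, ← h2]) (by rw [← h3, ← h4])
  apply hp
  refine Prod.ext h ?_
  rw [h1, h3, h]

/-- Membership in the set of **consecutive pairs** of a finite planar set `T` (pairs `(p, p')`
with `p₁ < p'₁` and no point of `T` strictly in between in abscissa). [folklore] -/
theorem mem_consecutive {T : Finset (ℝ × ℝ)} {pp : (ℝ × ℝ) × (ℝ × ℝ)} :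
    pp ∈ (T ×ˢ T).filter (fun pp : (ℝ × ℝ) × (ℝ × ℝ) =>
        pp.1.1 < pp.2.1 ∧ ∀ u ∈ T, ¬ (pp.1.1 < u.1 ∧ u.1 < pp.2.1)) ↔
      (pp.1 ∈ T ∧ pp.2 ∈ T) ∧ pp.1.1 < pp.2.1 ∧ ∀ u ∈ T, ¬ (pp.1.1 < u.1 ∧ u.1 < pp.2.1) := by
  rw [Finset.mem_filter, Finset.mem_product]

/-- Distinct consecutive pairs of a set with injective abscissa have disjoint open abscissa
ranges. [folklore] -/
theorem consecutive_disjoint {T : Finset (ℝ × ℝ)}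
    (hT : ∀ p ∈ T, ∀ p' ∈ T, p.1 = p'.1 → p = p') {pp pp' : (ℝ × ℝ) × (ℝ × ℝ)}
    (h : pp ∈ (T ×ˢ T).filter (fun pp : (ℝ × ℝ) × (ℝ × ℝ) =>
        pp.1.1 < pp.2.1 ∧ ∀ u ∈ T, ¬ (pp.1.1 < u.1 ∧ u.1 < pp.2.1)))
    (h' : pp' ∈ (T ×ˢ T).filter (fun pp : (ℝ × ℝ) × (ℝ × ℝ) =>
        pp.1.1 < pp.2.1 ∧ ∀ u ∈ T, ¬ (pp.1.1 < u.1 ∧ u.1 < pp.2.1)))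
    (hne : pp ≠ pp') {x : ℝ} (hx : pp.1.1 < x ∧ x < pp.2.1) (hx' : pp'.1.1 < x ∧ x < pp'.2.1) :
    False := by
  obtain ⟨⟨h1, h2⟩, hlt, hno⟩ := mem_consecutive.1 h
  obtain ⟨⟨h1', h2'⟩, hlt', hno'⟩ := mem_consecutive.1 h'
  rcases lt_trichotomy pp.1.1 pp'.1.1 with hl | he | hg
  · exact hno pp'.1 h1' ⟨hl, hx'.1.trans hx.2⟩
  · have hfst : pp.1 = pp'.1 := hT _ h1 _ h1' he
    rcases lt_trichotomy pp.2.1 pp'.2.1 with hl2 | he2 | hg2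
    · exact hno' pp.2 h2 ⟨by rw [← he]; exact hlt, hl2⟩
    · exact hne (Prod.ext hfst (hT _ h2 _ h2' he2))
    · exact hno pp'.2 h2' ⟨by rw [he]; exact hlt', hg2⟩
  · exact hno' pp.1 h1 ⟨hg, hx.1.trans hx'.2⟩

/-- A finite planar set with injective abscissa has at most (number of consecutive pairs) + 1
points: each non-rightmost point is followed by a next one. [folklore] -/
theorem card_le_card_consecutive_add_one (T : Finset (ℝ × ℝ))
    (hT : ∀ p ∈ T, ∀ p' ∈ T, p.1 = p'.1 → p = p') :
    T.card ≤ ((T ×ˢ T).filter (fun pp : (ℝ × ℝ) × (ℝ × ℝ) =>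
        pp.1.1 < pp.2.1 ∧ ∀ u ∈ T, ¬ (pp.1.1 < u.1 ∧ u.1 < pp.2.1))).card + 1 := by
  classical
  rcases T.eq_empty_or_nonempty with hempty | hne
  · rw [hempty]
    simp
  obtain ⟨M, hM, hMmax⟩ := T.exists_max_image Prod.fst hne
  have hnext : ∀ p ∈ T.erase M, ∃ n ∈ T, p.1 < n.1 ∧ ∀ u ∈ T, p.1 < u.1 → n.1 ≤ u.1 := by
    intro p hp
    obtain ⟨hpM, hpT⟩ := Finset.mem_erase.1 hp
    have hlt : p.1 < M.1 := by
      rcases (hMmax p hpT).lt_or_eq with h | h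
      · exact h
      · exact absurd (hT _ hpT _ hM h) hpM
    have hne' : (T.filter fun u => p.1 < u.1).Nonempty := ⟨M, Finset.mem_filter.2 ⟨hM, hlt⟩⟩
    obtain ⟨n, hn, hmin⟩ := (T.filter fun u => p.1 < u.1).exists_min_image Prod.fst hne'
    obtain ⟨hnT, hnlt⟩ := Finset.mem_filter.1 hn
    exact ⟨n, hnT, hnlt, fun u hu hu' => hmin u (Finset.mem_filter.2 ⟨hu, hu'⟩)⟩
  choose! nxt hnxtT hnxtlt hnxtmin using hnext
  have hsub : (T.erase M).card ≤ ((T ×ˢ T).filter (fun pp : (ℝ × ℝ) × (ℝ × ℝ) =>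
      pp.1.1 < pp.2.1 ∧ ∀ u ∈ T, ¬ (pp.1.1 < u.1 ∧ u.1 < pp.2.1))).card := by
    refine Finset.card_le_card_of_injOn (fun p => (p, nxt p)) ?_ ?_
    · intro p hp
      have hpT := (Finset.mem_erase.1 hp).2
      refine mem_consecutive.2 ⟨⟨hpT, hnxtT p hp⟩, hnxtlt p hp, fun u hu hu' => ?_⟩
      exact absurd hu'.2 (not_lt.2 (hnxtmin p hp u hu hu'.1))
    · intro p _ p' _ h
      exact (Prod.ext_iff.1 h).1
  have := Finset.card_erase_add_one hM
  omega

/-- **Incidences between points and translates of a strictly convex graph** (the case of the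
Pach–Sharir bound used in [EisenbrandEtAl2008], §2 display (1), proved by Székely's
crossing-lemma method, with explicit constants): for `φ` strictly convex and continuous and
finite `P, Q ⊆ ℝ²`,
`#{(p,q) ∈ P × Q : p.2 = φ (p.1 + q.1) - q.2} ≤ 4 #P^{2/3} #Q^{2/3} + 8 #P + #Q`.
[cite: EisenbrandEtAl2008, §2 display (1); graph-translate case with explicit constants] -/
theorem card_incidences_le (hφ : StrictConvexOn ℝ univ φ) (hφc : Continuous φ)
    (P Q : Finset (ℝ × ℝ)) :
    ((((P ×ˢ Q).filter fun pq : (ℝ × ℝ) × (ℝ × ℝ) =>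
        pq.1.2 = φ (pq.1.1 + pq.2.1) - pq.2.2).card : ℕ) : ℝ) ≤
      4 * (P.card : ℝ) ^ (2 / 3 : ℝ) * (Q.card : ℝ) ^ (2 / 3 : ℝ) + 8 * P.card + Q.card := by
  classical
  -- the points of `P` on the curve of `q`, consecutive pairs on it, and Székely's arcs
  obtain ⟨onC, honC⟩ : ∃ onC : ℝ × ℝ → Finset (ℝ × ℝ),
      onC = fun q => P.filter fun p => p.2 = φ (p.1 + q.1) - q.2 := ⟨_, rfl⟩
  have mem_onC : ∀ {q p : ℝ × ℝ}, p ∈ onC q ↔ p ∈ P ∧ p.2 = φ (p.1 + q.1) - q.2 := by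
    intro q p
    rw [honC, Finset.mem_filter]
  have hinjC : ∀ q, ∀ p ∈ onC q, ∀ p' ∈ onC q, p.1 = p'.1 → p = p' := by
    intro q p hp p' hp' h
    refine Prod.ext h ?_
    rw [(mem_onC.1 hp).2, (mem_onC.1 hp').2, h]
  obtain ⟨cons, hcons⟩ : ∃ cons : ℝ × ℝ → Finset ((ℝ × ℝ) × (ℝ × ℝ)), cons = fun q =>
      (onC q ×ˢ onC q).filter (fun pp : (ℝ × ℝ) × (ℝ × ℝ) =>
        pp.1.1 < pp.2.1 ∧ ∀ u ∈ onC q, ¬ (pp.1.1 < u.1 ∧ u.1 < pp.2.1)) := ⟨_, rfl⟩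
  have mem_cons : ∀ {q : ℝ × ℝ} {pp : (ℝ × ℝ) × (ℝ × ℝ)}, pp ∈ cons q ↔
      (pp.1 ∈ onC q ∧ pp.2 ∈ onC q) ∧ pp.1.1 < pp.2.1 ∧
        ∀ u ∈ onC q, ¬ (pp.1.1 < u.1 ∧ u.1 < pp.2.1) := by
    intro q pp
    rw [hcons, Finset.mem_filter, Finset.mem_product]
  have toF : ∀ {q : ℝ × ℝ} {pp : (ℝ × ℝ) × (ℝ × ℝ)}, pp ∈ cons q →
      pp ∈ (onC q ×ˢ onC q).filter (fun pp : (ℝ × ℝ) × (ℝ × ℝ) =>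
        pp.1.1 < pp.2.1 ∧ ∀ u ∈ onC q, ¬ (pp.1.1 < u.1 ∧ u.1 < pp.2.1)) := by
    intro q pp h
    rw [hcons] at h
    exact h
  obtain ⟨arcs, harcs⟩ : ∃ arcs : Finset ((ℝ × ℝ) × ((ℝ × ℝ) × (ℝ × ℝ))),
      arcs = (Q ×ˢ (P ×ˢ P)).filter (fun t => t.2 ∈ cons t.1) := ⟨_, rfl⟩
  have mem_arcs : ∀ {t : (ℝ × ℝ) × ((ℝ × ℝ) × (ℝ × ℝ))}, t ∈ arcs ↔ t.1 ∈ Q ∧ t.2 ∈ cons t.1 := by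
    intro t
    rw [harcs, Finset.mem_filter, Finset.mem_product, Finset.mem_product]
    constructor
    · rintro ⟨⟨hq, -⟩, h⟩
      exact ⟨hq, h⟩
    · rintro ⟨hq, h⟩
      have h' := mem_cons.1 h
      exact ⟨⟨hq, (mem_onC.1 h'.1.1).1, (mem_onC.1 h'.1.2).1⟩, h⟩
  -- Székely's arc system: vertices `P`, arcs = consecutive incidences along each translate
  obtain ⟨D, hV, hl, hr, hf⟩ : ∃ D : ArcSystem ↥arcs, D.V = P ∧
      (∀ t, D.l t = t.1.2.1) ∧ (∀ t, D.r t = t.1.2.2) ∧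
      (∀ t x, D.f t x = φ (x + t.1.1.1) - t.1.1.2) := by
    refine ⟨{ V := P
              l := fun t => t.1.2.1
              r := fun t => t.1.2.2
              f := fun t x => φ (x + t.1.1.1) - t.1.1.2
              l_mem := fun t => (mem_onC.1 (mem_cons.1 (mem_arcs.1 t.2).2).1.1).1
              r_mem := fun t => (mem_onC.1 (mem_cons.1 (mem_arcs.1 t.2).2).1.2).1
              fst_lt := fun t => (mem_cons.1 (mem_arcs.1 t.2).2).2.1
              f_l := fun t => ((mem_onC.1 (mem_cons.1 (mem_arcs.1 t.2).2).1.1).2).symm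
              f_r := fun t => ((mem_onC.1 (mem_cons.1 (mem_arcs.1 t.2).2).1.2).2).symm
              cont := fun t => by
                apply Continuous.continuousOn
                fun_prop
              avoid := fun t u hu h1 h2 h3 =>
                (mem_cons.1 (mem_arcs.1 t.2).2).2.2 u (mem_onC.2 ⟨hu, h3.symm⟩) ⟨h1, h2⟩
              simple := fun t t' hlt hrt => by
                have ht := mem_cons.1 (mem_arcs.1 t.2).2
                have ht' := mem_cons.1 (mem_arcs.1 t'.2).2
                have hpp : t.1.2.1 ≠ t.1.2.2 := fun h => by
                  have := ht.2.1
                  rw [h] at this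
                  exact lt_irrefl _ this
                have hq : t.1.1 = t'.1.1 :=
                  eq_of_inc_inc hφ hpp (mem_onC.1 ht.1.1).2
                    (by have := (mem_onC.1 ht'.1.1).2; rwa [← hlt] at this)
                    (mem_onC.1 ht.1.2).2
                    (by have := (mem_onC.1 ht'.1.2).2; rwa [← hrt] at this)
                exact Subtype.ext (Prod.ext hq (Prod.ext hlt hrt)) },
      rfl, fun _ => rfl, fun _ => rfl, fun _ _ => rfl⟩
  -- crossing arcs lie on distinct curves
  have hqne : ∀ t t', D.Crosses t t' → t.1.1 ≠ t'.1.1 := by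
    intro t t' h hq
    obtain ⟨hne, x, h1, h2, h3, h4, -⟩ := h
    rw [hl] at h1 h3
    rw [hr] at h2 h4
    have hc := (mem_arcs.1 t.2).2
    have hc' := (mem_arcs.1 t'.2).2
    rw [hq] at hc
    exact consecutive_disjoint (hinjC _) (toF hc) (toF hc')
      (fun h => hne (Subtype.ext (Prod.ext hq h))) ⟨h1, h2⟩ ⟨h3, h4⟩
  -- crossing arcs have four distinct endpoints (two curves meet only once)
  have h4 : ∀ t t', D.Crosses t t' →
      D.l t ≠ D.l t' ∧ D.l t ≠ D.r t' ∧ D.r t ≠ D.l t' ∧ D.r t ≠ D.r t' := by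
    intro t t' h
    have hq := hqne t t' h
    obtain ⟨hne, x, h1, h2, h3, h4, h5⟩ := h
    simp only [hl, hr] at h1 h2 h3 h4 ⊢
    rw [hf, hf] at h5
    have ht := mem_cons.1 (mem_arcs.1 t.2).2
    have ht' := mem_cons.1 (mem_arcs.1 t'.2).2
    have hil := (mem_onC.1 ht.1.1).2
    have hir := (mem_onC.1 ht.1.2).2
    have hil' := (mem_onC.1 ht'.1.1).2
    have hir' := (mem_onC.1 ht'.1.2).2
    have key : ∀ {a b : ℝ × ℝ}, a.2 = φ (a.1 + t.1.1.1) - t.1.1.2 →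
        b.2 = φ (b.1 + t'.1.1.1) - t'.1.1.2 → a = b → a.1 = x := by
      intro a b ha hb hab
      subst hab
      exact eq_of_translate_eq hφ hq (by rw [← ha, ← hb]) h5
    refine ⟨fun h => ?_, fun h => ?_, fun h => ?_, fun h => ?_⟩
    · have := key hil hil' h
      rw [this] at h1
      exact lt_irrefl _ h1
    · have := key hil hir' h
      rw [this] at h1
      exact lt_irrefl _ h1
    · have := key hir hil' h
      rw [this] at h2
      exact lt_irrefl _ h2
    · have := key hir hir' h
      rw [this] at h2
      exact lt_irrefl _ h2
  -- at most `#Q²` ordered crossing pairs: a crossing pair is determined by its pair of curves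
  have hX : (D.crossPairs Finset.univ).card ≤ Q.card * Q.card := by
    rw [← Finset.card_product]
    refine Finset.card_le_card_of_injOn (fun tt => (tt.1.1.1, tt.2.1.1)) ?_ ?_
    · intro tt _
      exact Finset.mem_product.2 ⟨(mem_arcs.1 tt.1.2).1, (mem_arcs.1 tt.2.2).1⟩
    · intro tt htt tt' htt' heq
      have hc := (D.mem_crossPairs.1 htt).2
      have hc' := (D.mem_crossPairs.1 htt').2
      have hq := hqne _ _ hc
      obtain ⟨e1, e2⟩ := Prod.ext_iff.1 heq
      dsimp only at e1 e2
      obtain ⟨-, x, hx1, hx2, hx3, hx4, hx5⟩ := hc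
      obtain ⟨-, x', hx1', hx2', hx3', hx4', hx5'⟩ := hc'
      rw [hl] at hx1 hx3 hx1' hx3'
      rw [hr] at hx2 hx4 hx2' hx4'
      rw [hf, hf] at hx5 hx5'
      rw [← e1, ← e2] at hx5'
      have hxx : x = x' := eq_of_translate_eq hφ hq hx5 hx5'
      subst hxx
      have f1 : tt.1 = tt'.1 := by
        by_contra hne
        have hm' : tt'.1.1.2 ∈ cons tt.1.1.1 := by
          have := (mem_arcs.1 tt'.1.2).2
          rwa [← e1] at this
        exact consecutive_disjoint (hinjC _) (toF (mem_arcs.1 tt.1.2).2) (toF hm')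
          (fun h => hne (Subtype.ext (Prod.ext e1 h))) ⟨hx1, hx2⟩ ⟨hx1', hx2'⟩
      have f2 : tt.2 = tt'.2 := by
        by_contra hne
        have hm' : tt'.2.1.2 ∈ cons tt.2.1.1 := by
          have := (mem_arcs.1 tt'.2.2).2
          rwa [← e2] at this
        exact consecutive_disjoint (hinjC _) (toF (mem_arcs.1 tt.2.2).2) (toF hm')
          (fun h => hne (Subtype.ext (Prod.ext e2 h))) ⟨hx3, hx4⟩ ⟨hx3', hx4'⟩
      exact Prod.ext f1 f2
  -- counting arcs against incidences: `I ≤ e + #Q`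
  have hIsum : ((P ×ˢ Q).filter fun pq : (ℝ × ℝ) × (ℝ × ℝ) =>
      pq.1.2 = φ (pq.1.1 + pq.2.1) - pq.2.2).card = ∑ q ∈ Q, (onC q).card := by
    rw [Finset.card_eq_sum_card_fiberwise (f := Prod.snd) (t := Q)
      (s := (P ×ˢ Q).filter fun pq : (ℝ × ℝ) × (ℝ × ℝ) => pq.1.2 = φ (pq.1.1 + pq.2.1) - pq.2.2)
      (fun pq hpq => (Finset.mem_product.1 (Finset.mem_filter.1 hpq).1).2)]
    refine Finset.sum_congr rfl fun q hq => ?_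
    have : ((P ×ˢ Q).filter fun pq : (ℝ × ℝ) × (ℝ × ℝ) =>
        pq.1.2 = φ (pq.1.1 + pq.2.1) - pq.2.2).filter (fun pq => pq.2 = q) =
        (onC q).image fun p => (p, q) := by
      ext pq
      simp only [Finset.mem_filter, Finset.mem_product, Finset.mem_image, mem_onC]
      constructor
      · rintro ⟨⟨⟨hp, -⟩, hinc⟩, rfl⟩
        exact ⟨pq.1, ⟨hp, hinc⟩, rfl⟩
      · rintro ⟨p, ⟨hp, hinc⟩, rfl⟩
        exact ⟨⟨⟨hp, hq⟩, hinc⟩, rfl⟩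
    rw [this, Finset.card_image_of_injective _ fun p p' h => (Prod.ext_iff.1 h).1]
  have hAsum : arcs.card = ∑ q ∈ Q, (cons q).card := by
    rw [Finset.card_eq_sum_card_fiberwise (f := Prod.fst) (s := arcs) (t := Q)
      (fun t ht => (mem_arcs.1 ht).1)]
    refine Finset.sum_congr rfl fun q hq => ?_
    have : arcs.filter (fun t => t.1 = q) = (cons q).image fun pp => (q, pp) := by
      ext t
      simp only [Finset.mem_image]
      rw [Finset.mem_filter, mem_arcs]
      constructor
      · rintro ⟨⟨-, hc⟩, rfl⟩
        exact ⟨t.2, hc, rfl⟩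
      · rintro ⟨pp, hc, rfl⟩
        exact ⟨⟨hq, hc⟩, rfl⟩
    rw [this, Finset.card_image_of_injective _ fun p p' h => (Prod.ext_iff.1 h).2]
  have hIe : ((P ×ˢ Q).filter fun pq : (ℝ × ℝ) × (ℝ × ℝ) =>
      pq.1.2 = φ (pq.1.1 + pq.2.1) - pq.2.2).card ≤ arcs.card + Q.card := by
    rw [hIsum, hAsum, Finset.card_eq_sum_ones Q, ← Finset.sum_add_distrib]
    refine Finset.sum_le_sum fun q _ => ?_
    have := card_le_card_consecutive_add_one (onC q) (hinjC q)
    rw [hcons]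
    exact this
  -- the crossing inequality (first drop the combinatorial bookkeeping from the context)
  clear hIsum hAsum toF mem_onC mem_cons mem_arcs hinjC hqne honC hcons harcs
  set e := arcs.card with he
  have hcard : Fintype.card ↥arcs = e := Fintype.card_coe _
  have hI : ((((P ×ˢ Q).filter fun pq : (ℝ × ℝ) × (ℝ × ℝ) =>
      pq.1.2 = φ (pq.1.1 + pq.2.1) - pq.2.2).card : ℕ) : ℝ) ≤ e + Q.card := by
    exact_mod_cast hIe
  have hm0 : (0 : ℝ) ≤ (P.card : ℝ) ^ (2 / 3 : ℝ) := Real.rpow_nonneg (Nat.cast_nonneg _) _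
  have hn0 : (0 : ℝ) ≤ (Q.card : ℝ) ^ (2 / 3 : ℝ) := Real.rpow_nonneg (Nat.cast_nonneg _) _
  have he_le : (e : ℝ) ≤ 4 * (P.card : ℝ) ^ (2 / 3 : ℝ) * (Q.card : ℝ) ^ (2 / 3 : ℝ) + 8 * P.card := by
    rcases lt_or_ge (Fintype.card ↥arcs) (8 * D.V.card) with hlt | hge
    · have : (e : ℝ) < 8 * P.card := by
        rw [hV] at hlt
        rw [← hcard]
        exact_mod_cast hlt
      nlinarith [mul_nonneg hm0 hn0]
    · have hXr := D.crossing_inequality h4 hge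
      rw [hcard, hV] at hXr
      have hXle : ((D.crossPairs Finset.univ).card : ℝ) ≤ (Q.card : ℝ) * (Q.card : ℝ) := by
        exact_mod_cast hX
      have hcube : (4 * (P.card : ℝ) ^ (2 / 3 : ℝ) * (Q.card : ℝ) ^ (2 / 3 : ℝ)) ^ 3 =
          64 * (P.card : ℝ) ^ 2 * (Q.card : ℝ) ^ 2 := by
        have hp : ((P.card : ℝ) ^ (2 / 3 : ℝ)) ^ 3 = (P.card : ℝ) ^ 2 := by
          rw [← Real.rpow_natCast, ← Real.rpow_mul (Nat.cast_nonneg _)]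
          norm_num
        have hq : ((Q.card : ℝ) ^ (2 / 3 : ℝ)) ^ 3 = (Q.card : ℝ) ^ 2 := by
          rw [← Real.rpow_natCast, ← Real.rpow_mul (Nat.cast_nonneg _)]
          norm_num
        calc (4 * (P.card : ℝ) ^ (2 / 3 : ℝ) * (Q.card : ℝ) ^ (2 / 3 : ℝ)) ^ 3
            = 64 * ((P.card : ℝ) ^ (2 / 3 : ℝ)) ^ 3 * ((Q.card : ℝ) ^ (2 / 3 : ℝ)) ^ 3 := by ring
          _ = 64 * (P.card : ℝ) ^ 2 * (Q.card : ℝ) ^ 2 := by rw [hp, hq]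
      have h3 : (e : ℝ) ^ 3 ≤ (4 * (P.card : ℝ) ^ (2 / 3 : ℝ) * (Q.card : ℝ) ^ (2 / 3 : ℝ)) ^ 3 := by
        rw [hcube]
        have hP2 : (0 : ℝ) ≤ 64 * (P.card : ℝ) ^ 2 := mul_nonneg (by norm_num) (sq_nonneg _)
        have step : 64 * (P.card : ℝ) ^ 2 * ((D.crossPairs Finset.univ).card : ℝ) ≤
            64 * (P.card : ℝ) ^ 2 * ((Q.card : ℝ) * (Q.card : ℝ)) :=
          mul_le_mul_of_nonneg_left hXle hP2
        have hsq : 64 * (P.card : ℝ) ^ 2 * ((Q.card : ℝ) * (Q.card : ℝ)) =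
            64 * (P.card : ℝ) ^ 2 * (Q.card : ℝ) ^ 2 := by ring
        exact (hXr.trans step).trans hsq.le
      have hB : (0 : ℝ) ≤ 4 * (P.card : ℝ) ^ (2 / 3 : ℝ) * (Q.card : ℝ) ^ (2 / 3 : ℝ) :=
        mul_nonneg (mul_nonneg (by norm_num) hm0) hn0
      have := le_of_pow_le_pow_left₀ three_ne_zero hB h3
      linarith [Nat.cast_nonneg (α := ℝ) P.card]
  linarith

end Szekely

/-! ## 2. Convexly independent subsets of Minkowski sums (EPRS 2008, Theorem 1) -/

namespace EPRS

open scoped Pointwise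

/-- A vector of `ℝ²` in the coordinate basis. [folklore] -/
theorem eq_smul_single_add (z : Fin 2 → ℝ) :
    z = z 0 • (Pi.single 0 1 : Fin 2 → ℝ) + z 1 • (Pi.single 1 1 : Fin 2 → ℝ) := by
  funext i
  fin_cases i <;> simp

/-- **Every point of a convexly independent finite planar set has a strict lower or a strict
upper supporting line against the other points** (strict separation of the point from the
convex hull of the others, then a case distinction on the direction of the separating
functional). [folklore] -/
theorem exists_support_of_convexIndependent {S : Finset (Fin 2 → ℝ)}
    (hS : ConvexIndependent ℝ (Subtype.val : ↥(S : Set (Fin 2 → ℝ)) → (Fin 2 → ℝ)))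
    {s : Fin 2 → ℝ} (hs : s ∈ S) :
    (∃ μ : ℝ, ∀ s' ∈ S, s' ≠ s → s 1 + μ * (s' 0 - s 0) < s' 1) ∨
      (∃ μ : ℝ, ∀ s' ∈ S, s' ≠ s → s' 1 < s 1 + μ * (s' 0 - s 0)) := by
  classical
  have hnot : s ∉ convexHull ℝ (↑(S.erase s) : Set (Fin 2 → ℝ)) := by
    have := (convexIndependent_set_iff_notMem_convexHull_sdiff.1 hS) s (Finset.mem_coe.2 hs)
    rwa [Finset.coe_erase]
  have hconv : Convex ℝ (convexHull ℝ (↑(S.erase s) : Set (Fin 2 → ℝ))) := convex_convexHull ℝ _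
  have hclosed : IsClosed (convexHull ℝ (↑(S.erase s) : Set (Fin 2 → ℝ))) :=
    ((S.erase s).finite_toSet.isCompact_convexHull (𝕜 := ℝ)).isClosed
  obtain ⟨f, u, hfs, hfB⟩ := geometric_hahn_banach_point_closed hconv hclosed hnot
  have hlt : ∀ s' ∈ S, s' ≠ s → f s < f s' := fun s' hs' hne =>
    hfs.trans (hfB s' (subset_convexHull ℝ _ (by simp [hs', hne])))
  set α : ℝ := f (Pi.single 0 1) with hα
  set β : ℝ := f (Pi.single 1 1) with hβ
  have hf : ∀ z : Fin 2 → ℝ, f z = α * z 0 + β * z 1 := by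
    intro z
    conv_lhs => rw [eq_smul_single_add z]
    rw [map_add, map_smul, map_smul, smul_eq_mul, smul_eq_mul]
    ring
  have hdiff : ∀ s' ∈ S, s' ≠ s → 0 < α * (s' 0 - s 0) + β * (s' 1 - s 1) := by
    intro s' hs' hne
    have := hlt s' hs' hne
    rw [hf, hf] at this
    linarith
  rcases lt_trichotomy 0 β with hb | hb | hb
  · -- a strict lower supporting line of slope `-α/β`
    refine Or.inl ⟨-α / β, fun s' hs' hne => ?_⟩
    have h := hdiff s' hs' hne
    have h2 : β * (s 1 + -α / β * (s' 0 - s 0)) < β * s' 1 := by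
      have : β * (s 1 + -α / β * (s' 0 - s 0)) = β * s 1 - α * (s' 0 - s 0) := by
        field_simp
        ring
      rw [this]
      linarith
    exact lt_of_mul_lt_mul_left h2 hb.le
  · -- `β = 0`: `s` has extreme abscissa; a steep line works
    refine Or.inl ?_
    have hα' : ∀ s' ∈ S, s' ≠ s → 0 < α * (s' 0 - s 0) := by
      intro s' hs' hne
      have := hdiff s' hs' hne
      rw [← hb] at this
      linarith
    rcases (S.erase s).eq_empty_or_nonempty with hempty | hne
    · refine ⟨0, fun s' hs' hne => ?_⟩
      have : s' ∈ S.erase s := Finset.mem_erase.2 ⟨hne, hs'⟩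
      rw [hempty] at this
      exact absurd this (Finset.notMem_empty _)
    · obtain ⟨s₁, hs₁⟩ := hne
      obtain ⟨hs₁ne, hs₁S⟩ := Finset.mem_erase.1 hs₁
      have hαne : α ≠ 0 := by
        intro h0
        have := hα' s₁ hs₁S hs₁ne
        rw [h0, zero_mul] at this
        exact lt_irrefl _ this
      set R : Finset ℝ := (S.erase s).image fun s' => (s' 1 - s 1) / (s' 0 - s 0) with hR
      have hRne : R.Nonempty := ⟨_, Finset.mem_image_of_mem _ hs₁⟩
      rcases lt_or_gt_of_ne hαne with hneg | hpos
      · -- all other points lie strictly to the left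
        refine ⟨R.max' hRne + 1, fun s' hs' hne => ?_⟩
        have hd : s' 0 - s 0 < 0 := by
          have := hα' s' hs' hne
          nlinarith
        have hle : (s' 1 - s 1) / (s' 0 - s 0) ≤ R.max' hRne :=
          R.le_max' _ (Finset.mem_image_of_mem _ (Finset.mem_erase.2 ⟨hne, hs'⟩))
        have hlt' : (s' 1 - s 1) / (s' 0 - s 0) < R.max' hRne + 1 := by linarith
        rw [div_lt_iff_of_neg hd] at hlt'
        linarith
      · -- all other points lie strictly to the right
        refine ⟨R.min' hRne - 1, fun s' hs' hne => ?_⟩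
        have hd : 0 < s' 0 - s 0 := by
          have := hα' s' hs' hne
          nlinarith
        have hle : R.min' hRne ≤ (s' 1 - s 1) / (s' 0 - s 0) :=
          R.min'_le _ (Finset.mem_image_of_mem _ (Finset.mem_erase.2 ⟨hne, hs'⟩))
        have hlt' : R.min' hRne - 1 < (s' 1 - s 1) / (s' 0 - s 0) := by linarith
        rw [lt_div_iff₀ hd] at hlt'
        linarith
  · -- a strict upper supporting line of slope `-α/β`
    refine Or.inr ⟨-α / β, fun s' hs' hne => ?_⟩
    have h := hdiff s' hs' hne
    have hβ0 : β ≠ 0 := hb.ne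
    have h2 : β * (s 1 + -α / β * (s' 0 - s 0)) < β * s' 1 := by
      have : β * (s 1 + -α / β * (s' 0 - s 0)) = β * s 1 - α * (s' 0 - s 0) := by
        field_simp
        ring
      rw [this]
      linarith
    exact lt_of_mul_lt_mul_of_nonpos_left h2 hb.le

/-- An upward parabola is strictly convex. [folklore] -/
theorem strictConvexOn_parabola (c₀ c₁ c₂ ε : ℝ) (hε : 0 < ε) :
    StrictConvexOn ℝ univ fun x => c₁ + c₂ * (x - c₀) + ε * (x - c₀) ^ 2 := by
  refine ⟨convex_univ, fun x _ y _ hxy a b ha hb hab => ?_⟩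
  have hb' : b = 1 - a := by linarith
  have key : a * (c₁ + c₂ * (x - c₀) + ε * (x - c₀) ^ 2) + b * (c₁ + c₂ * (y - c₀) + ε * (y - c₀) ^ 2)
      - (c₁ + c₂ * (a * x + b * y - c₀) + ε * (a * x + b * y - c₀) ^ 2) =
      ε * a * b * (x - y) ^ 2 := by
    rw [hb']
    ring
  have hpos : 0 < ε * a * b * (x - y) ^ 2 := by
    have hxy' : (x - y) ^ 2 > 0 := by
      have : x - y ≠ 0 := sub_ne_zero.2 hxy
      positivity
    positivity
  simp only [smul_eq_mul]
  linarith

/-- A pointwise maximum of finitely many strictly convex functions is strictly convex.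
[folklore] -/
theorem strictConvexOn_sup' {α : Type*} (L : Finset α) (hL : L.Nonempty) (g : α → ℝ → ℝ)
    (hg : ∀ a ∈ L, StrictConvexOn ℝ univ (g a)) :
    StrictConvexOn ℝ univ (fun x => L.sup' hL fun a => g a x) := by
  induction hL using Finset.Nonempty.cons_induction with
  | singleton a =>
    simp only [Finset.sup'_singleton]
    exact hg a (Finset.mem_singleton_self a)
  | cons a s ha hs ih =>
    have h1 : StrictConvexOn ℝ univ (g a) := hg a (Finset.mem_cons_self a s)
    have h2 := ih fun b hb => hg b (Finset.mem_cons.2 (Or.inr hb))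
    have heq : (fun x => (Finset.cons a s ha).sup' (Finset.cons_nonempty ha) fun b => g b x) =
        g a ⊔ fun x => s.sup' hs fun b => g b x := by
      funext x
      rw [Finset.sup'_cons hs]
      rfl
    rw [heq]
    exact h1.sup h2

/-- **A strictly convex continuous function through finitely many points with strict lower
supporting lines** (EPRS: "there is a strictly convex closed curve passing through all points
of `S`", made explicit for the lower chain): if every point of `L` has a strict lower supporting
line against the other points of `L`, the maximum of thin parabolas `s₁ + μ_s (x - s₀) + ε (x - s₀)²`
(`ε > 0` below every normalised gap) is strictly convex, continuous, and interpolates `L`.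
[folklore] -/
theorem exists_strictConvexOn_interpolant (L : Finset (Fin 2 → ℝ)) (hL : L.Nonempty)
    (hsupp : ∀ s ∈ L, ∃ μ : ℝ, ∀ s' ∈ L, s' ≠ s → s 1 + μ * (s' 0 - s 0) < s' 1) :
    ∃ φ : ℝ → ℝ, StrictConvexOn ℝ univ φ ∧ Continuous φ ∧ ∀ s ∈ L, φ (s 0) = s 1 := by
  classical
  choose! μ hμ using hsupp
  -- a common curvature `ε > 0` with `ε (s'₀ - s₀)² < gap(s, s')` for all `s ≠ s'` in `L`
  obtain ⟨ε, hε0, hε⟩ : ∃ ε : ℝ, 0 < ε ∧ ∀ s ∈ L, ∀ s' ∈ L, s' ≠ s →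
      ε * (s' 0 - s 0) ^ 2 < s' 1 - s 1 - μ s * (s' 0 - s 0) := by
    set prs := (L ×ˢ L).filter fun ss => ss.2 ≠ ss.1 with hprs
    have hgap : ∀ ss ∈ prs, 0 < ss.2 1 - ss.1 1 - μ ss.1 * (ss.2 0 - ss.1 0) := by
      intro ss hss
      obtain ⟨hss', hne⟩ := Finset.mem_filter.1 hss
      obtain ⟨h1, h2⟩ := Finset.mem_product.1 hss'
      have := hμ ss.1 h1 ss.2 h2 hne
      linarith
    rcases prs.eq_empty_or_nonempty with h0 | hne
    · refine ⟨1, one_pos, fun s hs s' hs' hne => ?_⟩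
      have : (s, s') ∈ prs := Finset.mem_filter.2 ⟨Finset.mem_product.2 ⟨hs, hs'⟩, hne⟩
      rw [h0] at this
      exact absurd this (Finset.notMem_empty _)
    · obtain ⟨ss₀, hss₀, hmin⟩ := prs.exists_min_image
        (fun ss => (ss.2 1 - ss.1 1 - μ ss.1 * (ss.2 0 - ss.1 0)) / ((ss.2 0 - ss.1 0) ^ 2 + 1)) hne
      set m := (ss₀.2 1 - ss₀.1 1 - μ ss₀.1 * (ss₀.2 0 - ss₀.1 0)) / ((ss₀.2 0 - ss₀.1 0) ^ 2 + 1)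
        with hm
      have hm0 : 0 < m := div_pos (hgap ss₀ hss₀) (by positivity)
      refine ⟨m / 2, by positivity, fun s hs s' hs' hne' => ?_⟩
      have hmem : (s, s') ∈ prs := Finset.mem_filter.2 ⟨Finset.mem_product.2 ⟨hs, hs'⟩, hne'⟩
      have hle : m ≤ (s' 1 - s 1 - μ s * (s' 0 - s 0)) / ((s' 0 - s 0) ^ 2 + 1) := hmin _ hmem
      have hg := hgap _ hmem
      dsimp only at hg
      have hd : (0 : ℝ) < (s' 0 - s 0) ^ 2 + 1 := by positivity
      rw [le_div_iff₀ hd] at hle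
      nlinarith
  refine ⟨fun x => L.sup' hL fun s => s 1 + μ s * (x - s 0) + ε * (x - s 0) ^ 2,
    strictConvexOn_sup' _ hL _ fun s _ => strictConvexOn_parabola (s 0) (s 1) (μ s) ε hε0,
    Continuous.finset_sup'_apply hL fun s _ => by fun_prop, fun s hs => ?_⟩
  refine le_antisymm (Finset.sup'_le _ _ fun s' hs' => ?_) ?_
  · by_cases h : s' = s
    · rw [h]
      simp
    · have := hε s' hs' s hs (Ne.symm h)
      linarith
  · calc s 1 = s 1 + μ s * (s 0 - s 0) + ε * (s 0 - s 0) ^ 2 := by simp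
      _ ≤ L.sup' hL fun s' => s' 1 + μ s' * (s 0 - s' 0) + ε * (s 0 - s' 0) ^ 2 :=
          Finset.le_sup' (fun s' => s' 1 + μ s' * (s 0 - s' 0) + ε * (s 0 - s' 0) ^ 2) hs

/-- **Lower points versus incidences** ([EisenbrandEtAl2008], proof of Theorem 2): if
`L ⊆ S ⊆ P + Q` and every point of `L` has a strict lower supporting line against the rest of
`S`, then `#L ≤ 4 #P^{2/3} #Q^{2/3} + 8 #P + #Q` — each `s = p + q ∈ L` is an incidence of `p` with
the translate by `-q` of a strictly convex graph through `L`. [cite: EisenbrandEtAl2008, Theorem 2] -/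
theorem card_le_of_lower_support (P Q S L : Finset (Fin 2 → ℝ)) (hS : S ⊆ P + Q) (hLS : L ⊆ S)
    (hsupp : ∀ s ∈ L, ∃ μ : ℝ, ∀ s' ∈ S, s' ≠ s → s 1 + μ * (s' 0 - s 0) < s' 1) :
    (L.card : ℝ) ≤
      4 * (P.card : ℝ) ^ (2 / 3 : ℝ) * (Q.card : ℝ) ^ (2 / 3 : ℝ) + 8 * P.card + Q.card := by
  classical
  rcases L.eq_empty_or_nonempty with h0 | hL
  · rw [h0, Finset.card_empty, Nat.cast_zero]
    positivity
  obtain ⟨φ, hφ, hφc, hφL⟩ := exists_strictConvexOn_interpolant L hL fun s hs => by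
    obtain ⟨μ, hμ⟩ := hsupp s hs
    exact ⟨μ, fun s' hs' hne => hμ s' (hLS hs') hne⟩
  -- coordinates `ℝ^{Fin 2} → ℝ × ℝ`
  have hinj : Function.Injective fun z : Fin 2 → ℝ => (z 0, z 1) := by
    intro z w h
    obtain ⟨h0, h1⟩ := Prod.ext_iff.1 h
    funext i
    fin_cases i
    · exact h0
    · exact h1
  set P' := P.image fun z : Fin 2 → ℝ => (z 0, z 1) with hP'def
  set Q' := Q.image fun z : Fin 2 → ℝ => (z 0, z 1) with hQ'def
  have hP' : P'.card = P.card := Finset.card_image_of_injective _ hinj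
  have hQ' : Q'.card = Q.card := Finset.card_image_of_injective _ hinj
  have hinc := Szekely.card_incidences_le hφ hφc P' Q'
  rw [hP', hQ'] at hinc
  have hrep : ∀ s ∈ L, ∃ pq : (Fin 2 → ℝ) × (Fin 2 → ℝ), pq.1 ∈ P ∧ pq.2 ∈ Q ∧ pq.1 + pq.2 = s := by
    intro s hs
    obtain ⟨p, hp, q, hq, hpq⟩ := Finset.mem_add.1 (hS (hLS hs))
    exact ⟨(p, q), hp, hq, hpq⟩
  choose! rep hrep1 hrep2 hrep3 using hrep
  have hcard : L.card ≤ ((P' ×ˢ Q').filter fun pq : (ℝ × ℝ) × (ℝ × ℝ) =>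
      pq.1.2 = φ (pq.1.1 + pq.2.1) - pq.2.2).card := by
    refine Finset.card_le_card_of_injOn
      (fun s => (((rep s).1 0, (rep s).1 1), ((rep s).2 0, (rep s).2 1))) ?_ ?_
    · intro s hs
      refine Finset.mem_filter.2 ⟨Finset.mem_product.2
        ⟨Finset.mem_image_of_mem _ (hrep1 s hs), Finset.mem_image_of_mem _ (hrep2 s hs)⟩, ?_⟩
      have hs0 : (rep s).1 0 + (rep s).2 0 = s 0 := by
        have := congrFun (hrep3 s hs) 0
        simpa using this
      have hs1 : (rep s).1 1 + (rep s).2 1 = s 1 := by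
        have := congrFun (hrep3 s hs) 1
        simpa using this
      dsimp only
      rw [hs0, hφL s hs]
      linarith
    · intro s hs s' hs' h
      obtain ⟨h1, h2⟩ := Prod.ext_iff.1 h
      have e1 : (rep s).1 = (rep s').1 := hinj h1
      have e2 : (rep s).2 = (rep s').2 := hinj h2
      rw [← hrep3 s hs, ← hrep3 s' hs', e1, e2]
  calc (L.card : ℝ) ≤ ((P' ×ˢ Q').filter fun pq : (ℝ × ℝ) × (ℝ × ℝ) =>
        pq.1.2 = φ (pq.1.1 + pq.2.1) - pq.2.2).card := by exact_mod_cast hcard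
    _ ≤ _ := hinc

/-- **Eisenbrand–Pach–Rothvoß–Sopher 2008, Theorem 1 (= KPTT 2015, Theorem 4), effective form.**
For finite `P, Q ⊆ ℝ²` and a convexly independent `S ⊆ P + Q`:
`#S ≤ 16 · (#P^{2/3} #Q^{2/3} + #P + #Q)`. [cite: EisenbrandEtAl2008, Theorem 1] -/
theorem card_le_of_convexIndependent_subset_add (P Q S : Finset (Fin 2 → ℝ)) (hS : S ⊆ P + Q)
    (hci : ConvexIndependent ℝ (Subtype.val : ↥(S : Set (Fin 2 → ℝ)) → (Fin 2 → ℝ))) :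
    (S.card : ℝ) ≤
      16 * ((P.card : ℝ) ^ (2 / 3 : ℝ) * (Q.card : ℝ) ^ (2 / 3 : ℝ) + P.card + Q.card) := by
  classical
  -- lower and upper points
  set Lo := S.filter fun s => ∃ μ : ℝ, ∀ s' ∈ S, s' ≠ s → s 1 + μ * (s' 0 - s 0) < s' 1
    with hLo
  set Up := S.filter fun s => ∃ μ : ℝ, ∀ s' ∈ S, s' ≠ s → s' 1 < s 1 + μ * (s' 0 - s 0)
    with hUp
  have hcover : S ⊆ Lo ∪ Up := by
    intro s hs
    rcases exists_support_of_convexIndependent hci hs with h | h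
    · exact Finset.mem_union_left _ (Finset.mem_filter.2 ⟨hs, h⟩)
    · exact Finset.mem_union_right _ (Finset.mem_filter.2 ⟨hs, h⟩)
  have h1 : S.card ≤ Lo.card + Up.card :=
    (Finset.card_le_card hcover).trans (Finset.card_union_le _ _)
  -- lower points
  have hLoS : Lo ⊆ S := Finset.filter_subset _ _
  have hL := card_le_of_lower_support P Q S Lo hS hLoS fun s hs => (Finset.mem_filter.1 hs).2
  -- upper points are lower points of `-S ⊆ -P + -Q`
  have hneg : S.image Neg.neg ⊆ P.image Neg.neg + Q.image Neg.neg := by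
    intro t ht
    obtain ⟨s, hs, rfl⟩ := Finset.mem_image.1 ht
    obtain ⟨p, hp, q, hq, hpq⟩ := Finset.mem_add.1 (hS hs)
    exact Finset.mem_add.2
      ⟨-p, Finset.mem_image_of_mem _ hp, -q, Finset.mem_image_of_mem _ hq, by rw [← hpq, neg_add]⟩
  have hUpS : Up.image Neg.neg ⊆ S.image Neg.neg :=
    Finset.image_subset_image (Finset.filter_subset _ _)
  have hU' := card_le_of_lower_support (P.image Neg.neg) (Q.image Neg.neg) (S.image Neg.neg)
    (Up.image Neg.neg) hneg hUpS (by
      intro t ht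
      obtain ⟨s, hs, rfl⟩ := Finset.mem_image.1 ht
      obtain ⟨hsS, μ, hμ⟩ := Finset.mem_filter.1 hs
      refine ⟨μ, fun t' ht' hne => ?_⟩
      obtain ⟨s', hs', rfl⟩ := Finset.mem_image.1 ht'
      have hne' : s' ≠ s := fun h => hne (by rw [h])
      have := hμ s' hs' hne'
      simp only [Pi.neg_apply]
      linarith)
  rw [Finset.card_image_of_injective _ neg_injective,
    Finset.card_image_of_injective _ neg_injective,
    Finset.card_image_of_injective _ neg_injective] at hU'
  have h1' : (S.card : ℝ) ≤ Lo.card + Up.card := by exact_mod_cast h1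
  have hA : (0 : ℝ) ≤ (P.card : ℝ) ^ (2 / 3 : ℝ) * (Q.card : ℝ) ^ (2 / 3 : ℝ) := by positivity
  have hP0 : (0 : ℝ) ≤ P.card := Nat.cast_nonneg _
  have hQ0 : (0 : ℝ) ≤ Q.card := Nat.cast_nonneg _
  linarith

end EPRS

/-! ## 3. The discharges -/

/-- **KPTT 2015, Theorem 5, discharged**: the Newton polygon of `Σ_{i<k} f_i g_i` with `r`-sparse
`f_i` and `s`-sparse `g_i` has at most `C k (r^{2/3}s^{2/3} + r + s)` vertices, `C` absolute, over
any field — the printed reduction to Theorem 4 (`theorem5_of_minkowski_convexIndependent_bound`)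
and the Eisenbrand–Pach–Rothvoß–Sopher bound with constant `16`
(`EPRS.card_le_of_convexIndependent_subset_add`). [cite: KoiranPortierTavenasThomasse2015, Theorem 5] -/
theorem theorem5_holds : theorem5 :=
  theorem5_of_minkowski_convexIndependent_bound
    ⟨16, fun P Q S hS hci => EPRS.card_le_of_convexIndependent_subset_add P Q S hS hci⟩

/-- **KPTT 2015, Theorem 6, discharged**: the Newton polygon of `Σ_{i<k} Π_{j<m} f_ij` with
`m ≥ 2` and `t`-sparse `f_ij` has at most `C k t^{2m/3}` vertices, over any field — Theorem 5 and
the printed splitting of each product into two halves (`theorem6_of_theorem5`).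
[cite: KoiranPortierTavenasThomasse2015, Theorem 6] -/
theorem theorem6_holds : theorem6 :=
  theorem6_of_theorem5 theorem5_holds

end KPTT

end Literature.Computability.AlgebraicComplexity
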